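import Literature.Analysis.FluidPDE.PressureRepresentation
import Literature.Analysis.FluidPDE.NSFourierBilinear
import Mathlib.Analysis.SpecialFunctions.JapaneseBracket
import HarnessLib

/-!
# The pressure potential for the Type I decay class (Pineau–Vicol 2026, towards Lemma 2.1 / 7.1)

Analysis/FluidPDE support file (all results proved; no named facts) in the discharge programme of
`Literature.Analysis.FluidPDE.pineauVicol2026_rdss_liouville` (B. Pineau, V. Vicol,
arXiv:2607.09619 (2026), Thm. 1.7). Lemmas 2.1 / 7.1 of the source use the pressure
representation `P = RᵢRⱼ(UⁱUʲ)` for profiles obeying only the Type I bound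
`|U(y)| ≤ C/(1+|y|)` — fields which are **not square integrable**. The tree's pressure potential
`pressurePotential v = −Q₁[v] − Q₂[v]` (`PressureRepresentation`, Gilbarg–Trudinger Lemma 4.2)
and its Poisson equation `ΔQ[v] = −∂ᵢ∂ⱼ(vᵢvⱼ)` are proved there for `|v|² ∈ L¹`; this file
re-proves them for the decay class `(1+|y|)|v(y)| ≤ C`, where the weight `v ⊗ v = O((1+|y|)⁻²)`
is not integrable but the far kernel decays:

* **parametric integrals, decaying kernel against decaying weight**
  (`integrable_/continuous_/hasFDerivAt_/fderiv_…_apply_/contDiff_two_integral_clm_apply_comp_sub_decay`):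
  the bounded-kernel/`L¹`-weight lemmas of `PressureRepresentation` with `‖DᵏΦ(z)‖ ≤ M/(1+|z|)³`
  and `‖L(y)‖ ≤ A/(1+|y|)²`, phrased with the tree's weighted sup-norm predicate `HasDecay K C f`
  (`NSFourierBilinear`; `hasDecay_iff_div`); Peetre's inequality `1+|y| ≤ (1+|x|)(1+|x−y|)` moves the decay
  onto the integrable dominator `(1+|y|)⁻⁵` on unit balls in `x` (`decay_mul_decay_le`);
* **decay of `D²Γ∞, D³Γ∞, D⁴Γ∞`** like `(1+|z|)⁻³` (`exists_hasDecay_fderiv_newtonFar`: off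
  the ball they are the derivatives of `Γ`, homogeneous of degrees `−3, −4, −5` —
  `norm_le_mul_zpow_of_homogeneous`, `exists_decay_of_homogeneous`, `hasDecay_three_of_eqOn_far`);
* **the far potential and the pressure potential for the decay class**:
  `contDiff_farPotential_decay`, `laplacian_farPotential_decay` (`ΔQ₂ = λ * G`),
  `contDiff_pressurePotential_decay`, `laplacian_pressurePotential_decay`
  (`ΔQ[v] = −G[v] = −∂ᵢ∂ⱼ(vᵢvⱼ)` for `v ∈ C⁴` with `(1+|y|)|v(y)| ≤ C`).

This is the first input of the pressure identification `∇p = ∇Q[u(t)]` for classical Type I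
solutions (the tree's `tao_pressure_normalisation_holds` assumes finite energy).

## References

* B. Pineau, V. Vicol, arXiv:2607.09619 (2026), Lemma 2.1 and its proof (p. 9–10: "`U ∈ L^q`
  for `q > 3` … `P = RᵢRⱼ(UⁱUʲ)`"), Lemma 7.1. [PineauVicol2026]
* D. Gilbarg, N. S. Trudinger, *Elliptic Partial Differential Equations of Second Order*
  (2001 reprint), Lemma 4.2. [GilbargTrudinger2001]
-/

noncomputable section

open MeasureTheory Set Filter Metric Topology InnerProductSpace Function
open scoped RealInnerProductSpace Laplacian ContDiff ENNReal

namespace Literature.Analysis.FluidPDE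

namespace PineauVicol2026

open Literature.Analysis.FluidPDE.FourierNS (HasDecay)

/-- Local notation for physical space `ℝ³ = EuclideanSpace ℝ (Fin 3)`. -/
local notation "ℝ³" => EuclideanSpace ℝ (Fin 3)

section KernelDecay

variable {F : Type*} [NormedAddCommGroup F] [NormedSpace ℝ F]
variable {G : Type*} [NormedAddCommGroup G] [NormedSpace ℝ G]

/-- `(1 + |y|)⁻⁵` is integrable on `ℝ³`. [folklore] -/
theorem integrable_inv_one_add_norm_pow_five : Integrable fun y : ℝ³ => ((1 + ‖y‖) ^ 5)⁻¹ := by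
  have h := integrable_one_add_norm (E := ℝ³) (μ := volume) (r := 5) (by simp; norm_num)
  refine h.congr (Eventually.of_forall fun y => ?_)
  have h0 : 0 < 1 + ‖y‖ := by positivity
  show (1 + ‖y‖) ^ (-(5 : ℝ)) = ((1 + ‖y‖) ^ 5)⁻¹
  rw [Real.rpow_neg h0.le, show (5 : ℝ) = ((5 : ℕ) : ℝ) by norm_num, Real.rpow_natCast]

/-- **Peetre's inequality, cubed and localised**: for `|x − x₀| < 1`,
`M/(1+|x−y|)³ · A/(1+|y|)² ≤ M A (2+|x₀|)³ / (1+|y|)⁵`. [folklore] -/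
theorem decay_mul_decay_le {M A : ℝ} (hM : 0 ≤ M) (hA : 0 ≤ A) {x₀ x : ℝ³} (hx : ‖x - x₀‖ < 1) (y : ℝ³) :
    M / (1 + ‖x - y‖) ^ 3 * (A / (1 + ‖y‖) ^ 2) ≤ M * A * (2 + ‖x₀‖) ^ 3 * ((1 + ‖y‖) ^ 5)⁻¹ := by
  have h1 : 0 < 1 + ‖x - y‖ := by positivity
  have h2 : 0 < 1 + ‖y‖ := by positivity
  -- Peetre: `1 + |y| ≤ (1 + |x|)(1 + |x − y|) ≤ (2 + |x₀|)(1 + |x − y|)`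
  have hx' : ‖x‖ ≤ 1 + ‖x₀‖ := by
    have := norm_le_norm_add_norm_sub' x x₀
    have := norm_sub_rev x x₀
    linarith [norm_nonneg (x - x₀)]
  have hp : 1 + ‖y‖ ≤ (2 + ‖x₀‖) * (1 + ‖x - y‖) := by
    have hy : ‖y‖ ≤ ‖x‖ + ‖x - y‖ := norm_le_norm_add_norm_sub x y
    nlinarith [norm_nonneg (x - y), norm_nonneg x₀]
  -- `1/(1+|x−y|) ≤ (2+|x₀|)/(1+|y|)`
  have hq : 1 / (1 + ‖x - y‖) ≤ (2 + ‖x₀‖) / (1 + ‖y‖) := by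
    rw [div_le_div_iff₀ h1 h2]; linarith
  have hq3 : (1 / (1 + ‖x - y‖)) ^ 3 ≤ ((2 + ‖x₀‖) / (1 + ‖y‖)) ^ 3 :=
    pow_le_pow_left₀ (by positivity) hq 3
  have e1 : M / (1 + ‖x - y‖) ^ 3 * (A / (1 + ‖y‖) ^ 2) = M * A * (1 / (1 + ‖x - y‖)) ^ 3 * ((1 + ‖y‖) ^ 2)⁻¹ := by
    field_simp
  have e2 : M * A * (2 + ‖x₀‖) ^ 3 * ((1 + ‖y‖) ^ 5)⁻¹ = M * A * ((2 + ‖x₀‖) / (1 + ‖y‖)) ^ 3 * ((1 + ‖y‖) ^ 2)⁻¹ := by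
    field_simp
  rw [e1, e2]
  exact mul_le_mul_of_nonneg_right (mul_le_mul_of_nonneg_left hq3 (by positivity)) (by positivity)

/-- The tree's weighted sup-norm predicate `HasDecay K C f` (`‖f ξ‖ ≤ C (1+|ξ|)^{−K}`,
`NSFourierBilinear`) in quotient form. [folklore] -/
theorem hasDecay_iff_div {X F' : Type*} [NormedAddCommGroup X] [NormedAddCommGroup F'] {K : ℕ} {C : ℝ}
    {f : X → F'} : HasDecay K C f ↔ ∀ z, ‖f z‖ ≤ C / (1 + ‖z‖) ^ K := by
  simp only [HasDecay, div_eq_mul_inv]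

omit [NormedSpace ℝ F] [NormedSpace ℝ G] in
/-- The localised dominator: for `|x − x₀| < 1`, `‖L y‖ ‖Φ(x − y)‖ ≤ M A (2+|x₀|)³ (1+|y|)⁻⁵`. [folklore] -/
theorem norm_mul_norm_comp_sub_le {Φ : ℝ³ → F} {L : ℝ³ → G} {M A : ℝ} (hΦ : HasDecay 3 M Φ)
    (hL : HasDecay 2 A L) {x₀ x : ℝ³} (hx : ‖x - x₀‖ < 1) (y : ℝ³) :
    ‖L y‖ * ‖Φ (x - y)‖ ≤ M * A * (2 + ‖x₀‖) ^ 3 * ((1 + ‖y‖) ^ 5)⁻¹ := by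
  calc ‖L y‖ * ‖Φ (x - y)‖ ≤ A / (1 + ‖y‖) ^ 2 * (M / (1 + ‖x - y‖) ^ 3) :=
        mul_le_mul (hL y) (hΦ _) (norm_nonneg _) (by have := hL.nonneg; positivity)
    _ = M / (1 + ‖x - y‖) ^ 3 * (A / (1 + ‖y‖) ^ 2) := mul_comm _ _
    _ ≤ _ := decay_mul_decay_le hΦ.nonneg hL.nonneg hx y

/-- Integrability of `y ↦ L(y)(Φ(x - y))` for a decaying continuous `Φ` and a decaying
continuous operator-valued weight `L`. [folklore] -/
theorem integrable_clm_apply_comp_sub_decay {Φ : ℝ³ → F} {L : ℝ³ → F →L[ℝ] G} (hΦc : Continuous Φ)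
    {M A : ℝ} (hΦ : HasDecay 3 M Φ) (hLc : Continuous L) (hL : HasDecay 2 A L) (x : ℝ³) :
    Integrable fun y => L y (Φ (x - y)) := by
  refine Integrable.mono' (integrable_inv_one_add_norm_pow_five.const_mul (M * A * (2 + ‖x‖) ^ 3))
    (hLc.clm_apply (hΦc.comp (continuous_const.sub continuous_id))).aestronglyMeasurable
    (Eventually.of_forall fun y => ?_)
  exact (ContinuousLinearMap.le_opNorm _ _).trans (norm_mul_norm_comp_sub_le hΦ hL (by simp) y)

/-- **Continuity** of `x ↦ ∫ L(y)(Φ(x - y)) dy` (decaying kernel and weight; dominated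
convergence on unit balls). [folklore] -/
theorem continuous_integral_clm_apply_comp_sub_decay {Φ : ℝ³ → F} {L : ℝ³ → F →L[ℝ] G}
    (hΦc : Continuous Φ) {M A : ℝ} (hΦ : HasDecay 3 M Φ) (hLc : Continuous L) (hL : HasDecay 2 A L) :
    Continuous fun x => ∫ y, L y (Φ (x - y)) := by
  refine continuous_iff_continuousAt.2 fun x₀ => ?_
  have hmeas : ∀ x, AEStronglyMeasurable (fun y => L y (Φ (x - y))) volume := fun x =>
    (hLc.clm_apply (hΦc.comp (continuous_const.sub continuous_id))).aestronglyMeasurable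
  refine continuousAt_of_dominated (bound := fun y => M * A * (2 + ‖x₀‖) ^ 3 * ((1 + ‖y‖) ^ 5)⁻¹)
    (Eventually.of_forall hmeas) ?_ (integrable_inv_one_add_norm_pow_five.const_mul _) ?_
  · have hball : ball x₀ 1 ∈ 𝓝 x₀ := ball_mem_nhds x₀ one_pos
    filter_upwards [hball] with x hx
    exact Eventually.of_forall fun y =>
      (ContinuousLinearMap.le_opNorm _ _).trans (norm_mul_norm_comp_sub_le hΦ hL (mem_ball_iff_norm.1 hx) y)
  · exact Eventually.of_forall fun y =>
      ((L y).continuous.comp (hΦc.comp (continuous_id.sub continuous_const))).continuousAt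

/-- **Differentiation under the integral sign** for `x ↦ ∫ L(y)(Φ(x - y)) dy` with `Φ ∈ C¹`,
`Φ` and `DΦ` decaying like `(1+|z|)⁻³`, and a decaying weight `L`: the derivative is
`∫ L(y) ∘ DΦ(x - y) dy`. [folklore] -/
theorem hasFDerivAt_integral_clm_apply_comp_sub_decay {Φ : ℝ³ → F} {L : ℝ³ → F →L[ℝ] G}
    (hΦ1 : ContDiff ℝ 1 Φ) {M₀ M₁ A : ℝ} (hM₀ : HasDecay 3 M₀ Φ) (hM₁ : HasDecay 3 M₁ (fderiv ℝ Φ))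
    (hLc : Continuous L) (hL : HasDecay 2 A L) (x₀ : ℝ³) :
    HasFDerivAt (fun x => ∫ y, L y (Φ (x - y))) (∫ y, (L y).comp (fderiv ℝ Φ (x₀ - y))) x₀ := by
  have hΦc : Continuous Φ := hΦ1.continuous
  have hDΦ : Continuous (fderiv ℝ Φ) := hΦ1.continuous_fderiv one_ne_zero
  refine hasFDerivAt_integral_of_dominated_of_fderiv_le
    (F' := fun x y => (L y).comp (fderiv ℝ Φ (x - y)))
    (bound := fun y => M₁ * A * (2 + ‖x₀‖) ^ 3 * ((1 + ‖y‖) ^ 5)⁻¹) (ball_mem_nhds x₀ one_pos) ?_ ?_ ?_ ?_ ?_ ?_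
  · exact Eventually.of_forall fun x =>
      (hLc.clm_apply (hΦc.comp (continuous_const.sub continuous_id))).aestronglyMeasurable
  · exact integrable_clm_apply_comp_sub_decay hΦc hM₀ hLc hL x₀
  · exact (hLc.clm_comp (hDΦ.comp (continuous_const.sub continuous_id))).aestronglyMeasurable
  · refine Eventually.of_forall fun y x hx => (ContinuousLinearMap.opNorm_comp_le _ _).trans ?_
    exact norm_mul_norm_comp_sub_le hM₁ hL (mem_ball_iff_norm.1 hx) y
  · exact integrable_inv_one_add_norm_pow_five.const_mul _
  · refine Eventually.of_forall fun y x _ => ?_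
    have h1 : HasFDerivAt (fun x : ℝ³ => Φ (x - y)) (fderiv ℝ Φ (x - y)) x := by
      have := ((hΦ1.differentiable one_ne_zero) (x - y)).hasFDerivAt.comp x (hasFDerivAt_sub_const y)
      rwa [ContinuousLinearMap.comp_id] at this
    exact (L y).hasFDerivAt.comp x h1

/-- The directional derivative formula `∂ₐ ∫ L(y)(Φ(x - y)) dy = ∫ L(y)(DΦ(x - y) a) dy`
(decay class). [folklore] -/
theorem fderiv_integral_clm_apply_comp_sub_apply_decay [CompleteSpace G] {Φ : ℝ³ → F}
    {L : ℝ³ → F →L[ℝ] G} (hΦ1 : ContDiff ℝ 1 Φ) {M₀ M₁ A : ℝ} (hM₀ : HasDecay 3 M₀ Φ)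
    (hM₁ : HasDecay 3 M₁ (fderiv ℝ Φ)) (hLc : Continuous L) (hL : HasDecay 2 A L) (x a : ℝ³) :
    fderiv ℝ (fun x => ∫ y, L y (Φ (x - y))) x a = ∫ y, L y (fderiv ℝ Φ (x - y) a) := by
  rw [(hasFDerivAt_integral_clm_apply_comp_sub_decay hΦ1 hM₀ hM₁ hLc hL x).fderiv,
    ContinuousLinearMap.integral_apply]
  · rfl
  · refine Integrable.mono' (integrable_inv_one_add_norm_pow_five.const_mul (M₁ * A * (2 + ‖x‖) ^ 3))
      (hLc.clm_comp ((hΦ1.continuous_fderiv one_ne_zero).comp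
        (continuous_const.sub continuous_id))).aestronglyMeasurable
      (Eventually.of_forall fun y => (ContinuousLinearMap.opNorm_comp_le _ _).trans
        (norm_mul_norm_comp_sub_le hM₁ hL (by simp) y))

-- nested operator types `(ℝ³ →L[ℝ] F) →L[ℝ] ℝ³ →L[ℝ] G`
set_option maxSynthPendingDepth 3 in
/-- **`C²` regularity** of `x ↦ ∫ L(y)(Φ(x - y)) dy` for `Φ ∈ C²` with `Φ`, `DΦ`, `D²Φ` decaying
like `(1+|z|)⁻³` and a continuous weight with `‖L y‖ ≤ A/(1+|y|)²` (NOT integrable), with the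
formula `∂ₐ∂ₐ ∫ L(y)(Φ(x - y)) dy = ∫ L(y)(D²Φ(x - y)(a, a)) dy` (Peetre's inequality moves the
decay of the kernel onto the weight: dominators `(1+|y|)⁻⁵` on unit balls). [folklore] -/
theorem contDiff_two_integral_clm_apply_comp_sub_decay [CompleteSpace G] {Φ : ℝ³ → F}
    {L : ℝ³ → F →L[ℝ] G} (hΦ : ContDiff ℝ 2 Φ) {M₀ M₁ M₂ A : ℝ} (hM₀ : HasDecay 3 M₀ Φ)
    (hM₁ : HasDecay 3 M₁ (fderiv ℝ Φ)) (hM₂ : HasDecay 3 M₂ (fderiv ℝ (fderiv ℝ Φ)))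
    (hLc : Continuous L) (hL : HasDecay 2 A L) :
    ContDiff ℝ 2 (fun x => ∫ y, L y (Φ (x - y))) ∧
      ∀ x a, fderiv ℝ (fun x' => fderiv ℝ (fun x => ∫ y, L y (Φ (x - y))) x' a) x a =
        ∫ y, L y (fderiv ℝ (fderiv ℝ Φ) (x - y) a a) := by
  have hΦ1 : ContDiff ℝ 1 Φ := hΦ.of_le one_le_two
  have hDΦ : ContDiff ℝ 1 (fderiv ℝ Φ) := hΦ.fderiv_right (m := 1) le_rfl
  have hM₁0 := hM₁.nonneg
  have hM₂0 := hM₂.nonneg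
  -- the directional derivatives of `Φ`
  have hΦa : ∀ a, ContDiff ℝ 1 fun z => fderiv ℝ Φ z a := fun a => hDΦ.clm_apply contDiff_const
  have hΦa0 : ∀ a, HasDecay 3 (M₁ * ‖a‖) (fun z => fderiv ℝ Φ z a) := fun a z => by
    calc ‖fderiv ℝ Φ z a‖ ≤ ‖fderiv ℝ Φ z‖ * ‖a‖ := ContinuousLinearMap.le_opNorm _ _
      _ ≤ M₁ / (1 + ‖z‖) ^ 3 * ‖a‖ := mul_le_mul_of_nonneg_right (hM₁ z) (norm_nonneg _)
      _ = M₁ * ‖a‖ / (1 + ‖z‖) ^ 3 := by ring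
  have hΦa1 : ∀ a, HasDecay 3 (M₂ * ‖a‖) (fderiv ℝ (fun z => fderiv ℝ Φ z a)) := fun a z => by
    have hd : DifferentiableAt ℝ (fderiv ℝ Φ) z := (hDΦ.differentiable one_ne_zero) z
    rw [fderiv_clm_apply hd (differentiableAt_const a)]
    simp only [fderiv_fun_const, Pi.zero_apply, ContinuousLinearMap.comp_zero, zero_add]
    refine ContinuousLinearMap.opNorm_le_bound _ (by positivity) fun w => ?_
    rw [ContinuousLinearMap.flip_apply]
    calc ‖fderiv ℝ (fderiv ℝ Φ) z w a‖ ≤ ‖fderiv ℝ (fderiv ℝ Φ) z w‖ * ‖a‖ :=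
          ContinuousLinearMap.le_opNorm _ _
      _ ≤ ‖fderiv ℝ (fderiv ℝ Φ) z‖ * ‖w‖ * ‖a‖ := by
          gcongr; exact ContinuousLinearMap.le_opNorm _ _
      _ ≤ M₂ / (1 + ‖z‖) ^ 3 * ‖w‖ * ‖a‖ := by gcongr; exact hM₂ z
      _ = M₂ * ‖a‖ / (1 + ‖z‖) ^ 3 * ‖w‖ := by ring
  -- first derivatives
  have hD1 : ∀ x, HasFDerivAt (fun x => ∫ y, L y (Φ (x - y)))
      (∫ y, (L y).comp (fderiv ℝ Φ (x - y))) x :=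
    fun x => hasFDerivAt_integral_clm_apply_comp_sub_decay hΦ1 hM₀ hM₁ hLc hL x
  have hfa : ∀ a, (fun x => fderiv ℝ (fun x => ∫ y, L y (Φ (x - y))) x a) =
      fun x => ∫ y, L y ((fun z => fderiv ℝ Φ z a) (x - y)) := fun a =>
    funext fun x => fderiv_integral_clm_apply_comp_sub_apply_decay hΦ1 hM₀ hM₁ hLc hL x a
  -- second derivatives
  have hD2 : ∀ a x, HasFDerivAt (fun x => ∫ y, L y ((fun z => fderiv ℝ Φ z a) (x - y)))
      (∫ y, (L y).comp (fderiv ℝ (fun z => fderiv ℝ Φ z a) (x - y))) x := fun a x =>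
    hasFDerivAt_integral_clm_apply_comp_sub_decay (hΦa a) (hΦa0 a) (hΦa1 a) hLc hL x
  -- continuity of the second derivatives
  have hL'c : Continuous fun y => (ContinuousLinearMap.compL ℝ ℝ³ F G) (L y) :=
    (ContinuousLinearMap.compL ℝ ℝ³ F G).continuous.comp hLc
  have hL' : HasDecay 2 (‖ContinuousLinearMap.compL ℝ ℝ³ F G‖ * A) (fun y => (ContinuousLinearMap.compL ℝ ℝ³ F G) (L y)) := by
    intro y
    calc ‖(ContinuousLinearMap.compL ℝ ℝ³ F G) (L y)‖ ≤ ‖ContinuousLinearMap.compL ℝ ℝ³ F G‖ * ‖L y‖ :=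
          ContinuousLinearMap.le_opNorm _ _
      _ ≤ ‖ContinuousLinearMap.compL ℝ ℝ³ F G‖ * (A / (1 + ‖y‖) ^ 2) :=
          mul_le_mul_of_nonneg_left (hL y) (norm_nonneg _)
      _ = ‖ContinuousLinearMap.compL ℝ ℝ³ F G‖ * A / (1 + ‖y‖) ^ 2 := by ring
  have hcont2 : ∀ a, Continuous fun x =>
      ∫ y, (L y).comp (fderiv ℝ (fun z => fderiv ℝ Φ z a) (x - y)) := fun a => by
    have := continuous_integral_clm_apply_comp_sub_decay (Φ := fderiv ℝ (fun z => fderiv ℝ Φ z a))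
      (L := fun y => (ContinuousLinearMap.compL ℝ ℝ³ F G) (L y))
      ((hΦa a).continuous_fderiv one_ne_zero) (hΦa1 a) hL'c hL'
    simpa using this
  refine ⟨?_, fun x a => ?_⟩
  · rw [show (2 : WithTop ℕ∞) = 1 + 1 from rfl, contDiff_succ_iff_fderiv_apply]
    refine ⟨fun x => (hD1 x).differentiableAt, fun h => absurd h (by norm_cast), fun a => ?_⟩
    rw [hfa a, contDiff_one_iff_fderiv]
    refine ⟨fun x => (hD2 a x).differentiableAt, ?_⟩
    have : fderiv ℝ (fun x => ∫ y, L y ((fun z => fderiv ℝ Φ z a) (x - y))) =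
        fun x => ∫ y, (L y).comp (fderiv ℝ (fun z => fderiv ℝ Φ z a) (x - y)) :=
      funext fun x => (hD2 a x).fderiv
    rw [this]
    exact hcont2 a
  · rw [hfa a, fderiv_integral_clm_apply_comp_sub_apply_decay (hΦa a) (hΦa0 a) (hΦa1 a) hLc hL x a]
    refine integral_congr_ae (Eventually.of_forall fun y => ?_)
    have hd : DifferentiableAt ℝ (fderiv ℝ Φ) (x - y) := (hDΦ.differentiable one_ne_zero) _
    simp only
    rw [fderiv_clm_apply hd (differentiableAt_const a)]
    simp

end KernelDecay

/-! ### Decay of the derivatives of the far-field Newton kernel `Γ∞` -/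

section NewtonDecay

-- nested operator types `ℝ³ →L[ℝ] ℝ³ →L[ℝ] ℝ³ →L[ℝ] ℝ³ →L[ℝ] ℝ`
set_option maxSynthPendingDepth 3

variable {F : Type*} [NormedAddCommGroup F] [NormedSpace ℝ F]

/-- A function homogeneous of degree `m` and bounded by `M` off the unit ball satisfies
`‖Φ z‖ ≤ M |z|^m` for `|z| ≥ 1`. [folklore] -/
theorem norm_le_mul_zpow_of_homogeneous (Φ : ℝ³ → F) (m : ℤ)
    (hΦ : ∀ c : ℝ, 0 < c → ∀ z, Φ (c • z) = c ^ m • Φ z) {M : ℝ}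
    (hM : ∀ w, 1 ≤ ‖w‖ → ‖Φ w‖ ≤ M) {z : ℝ³} (hz : 1 ≤ ‖z‖) : ‖Φ z‖ ≤ M * ‖z‖ ^ m := by
  have hz0 : 0 < ‖z‖ := one_pos.trans_le hz
  set w := ‖z‖⁻¹ • z with hw
  have hwn : ‖w‖ = 1 := by
    rw [hw, norm_smul, norm_inv, norm_norm, inv_mul_cancel₀ hz0.ne']
  have hzw : z = ‖z‖ • w := by rw [hw, smul_smul, mul_inv_cancel₀ hz0.ne', one_smul]
  have hM0 : 0 ≤ M := (norm_nonneg _).trans (hM w hwn.ge)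
  have key : ‖Φ z‖ = ‖z‖ ^ m * ‖Φ w‖ := by
    conv_lhs => rw [hzw, hΦ _ hz0 w]
    rw [norm_smul, norm_zpow, norm_norm]
  rw [key, mul_comm]
  exact mul_le_mul_of_nonneg_right (hM w hwn.ge) (by positivity)

/-- Decay bound for a continuous function off the origin, homogeneous of nonpositive degree `m`:
`‖Φ z‖ ≤ M |z|^m` for `|z| ≥ 1`. [folklore] -/
theorem exists_decay_of_homogeneous (Φ : ℝ³ → F) (m : ℤ) (hm : m ≤ 0)
    (hΦ : ∀ c : ℝ, 0 < c → ∀ z, Φ (c • z) = c ^ m • Φ z) (hc : ContinuousOn Φ {0}ᶜ) :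
    ∃ M, 0 ≤ M ∧ ∀ z, 1 ≤ ‖z‖ → ‖Φ z‖ ≤ M * ‖z‖ ^ m := by
  obtain ⟨M, hM⟩ := exists_bound_of_homogeneous Φ m hm hΦ hc one_pos
  refine ⟨max M 0, le_max_right _ _, fun z hz => ?_⟩
  exact (norm_le_mul_zpow_of_homogeneous Φ m hΦ (fun w hw => (hM w hw).trans (le_max_left _ _)) hz)

omit [NormedSpace ℝ F] in
/-- **From a far-field identification to `HasDecay 3`.** If `Ψ` is continuous, agrees with `Φ`
off the ball of radius `r`, and `‖Φ z‖ ≤ M |z|^m` for `|z| ≥ 1` with `m ≤ −3`, then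
`‖Ψ z‖ ≤ M'/(1+|z|)³` for all `z`. [folklore] -/
theorem hasDecay_three_of_eqOn_far {Ψ Φ : ℝ³ → F} (hΨ : Continuous Ψ) {r : ℝ} (hr : 0 ≤ r)
    (heq : ∀ z, r < ‖z‖ → Ψ z = Φ z) {M : ℝ} (hM0 : 0 ≤ M) {m : ℤ} (hm : m ≤ -3)
    (hM : ∀ z, 1 ≤ ‖z‖ → ‖Φ z‖ ≤ M * ‖z‖ ^ m) : ∃ M', HasDecay 3 M' Ψ := by
  obtain ⟨M₂, hM₂⟩ := (isCompact_closedBall (0 : ℝ³) (r + 1)).exists_bound_of_continuousOn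
    hΨ.continuousOn
  have hM₂0 : 0 ≤ M₂ := (norm_nonneg _).trans (hM₂ 0 (by simp; linarith))
  refine ⟨M₂ * (r + 2) ^ 3 + 8 * M, hasDecay_iff_div.2 fun z => ?_⟩
  have h1 : 0 < 1 + ‖z‖ := by positivity
  by_cases hz : ‖z‖ ≤ r + 1
  · -- inside: `‖Ψ z‖ ≤ M₂ ≤ M₂ (r+2)³/(1+|z|)³`
    have hb := hM₂ z (mem_closedBall_zero_iff.2 hz)
    rw [le_div_iff₀ (by positivity)]
    have h2 : (1 + ‖z‖) ^ 3 ≤ (r + 2) ^ 3 := pow_le_pow_left₀ h1.le (by linarith) 3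
    nlinarith [pow_nonneg h1.le 3, mul_nonneg hM₂0 (sub_nonneg.2 h2)]
  · rw [not_le] at hz
    have hz1 : 1 ≤ ‖z‖ := by linarith
    rw [heq z (by linarith)]
    have hb := hM z hz1
    -- `‖z‖^m ≤ ‖z‖^{-3} ≤ 8/(1+‖z‖)³` for `‖z‖ ≥ 1`
    have hzm : ‖z‖ ^ m ≤ ‖z‖ ^ (-3 : ℤ) := zpow_le_zpow_right₀ hz1 hm
    have hz0 : 0 < ‖z‖ := one_pos.trans_le hz1
    have hz3 : ‖z‖ ^ (-3 : ℤ) ≤ 8 / (1 + ‖z‖) ^ 3 := by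
      rw [show (-3 : ℤ) = -((3 : ℕ) : ℤ) by norm_num, zpow_neg, zpow_natCast, inv_eq_one_div,
        div_le_div_iff₀ (by positivity) (by positivity)]
      have : (1 + ‖z‖) ^ 3 ≤ (2 * ‖z‖) ^ 3 := pow_le_pow_left₀ h1.le (by linarith) 3
      nlinarith
    have hmain : ‖Φ z‖ ≤ 8 * M / (1 + ‖z‖) ^ 3 := by
      calc ‖Φ z‖ ≤ M * ‖z‖ ^ m := hb
        _ ≤ M * ‖z‖ ^ (-3 : ℤ) := mul_le_mul_of_nonneg_left hzm hM0
        _ ≤ M * (8 / (1 + ‖z‖) ^ 3) := mul_le_mul_of_nonneg_left hz3 hM0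
        _ = 8 * M / (1 + ‖z‖) ^ 3 := by ring
    refine hmain.trans ?_
    rw [div_le_div_iff_of_pos_right (by positivity)]
    nlinarith [pow_nonneg (show (0:ℝ) ≤ r + 2 by linarith) 3]

variable {r₀ r₁ : ℝ}

/-- **`D²Γ∞`, `D³Γ∞`, `D⁴Γ∞` decay like `(1+|z|)⁻³`** (off the ball they are the derivatives
of `Γ`, homogeneous of degrees `−3, −4, −5`; inside they are bounded). [folklore] -/
theorem exists_hasDecay_fderiv_newtonFar (h₀ : 0 < r₀) (h₁ : r₀ < r₁) :
    (∃ M, HasDecay 3 M (fderiv ℝ (fderiv ℝ (newtonFar r₀ r₁)))) ∧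
    (∃ M, HasDecay 3 M (fderiv ℝ (fderiv ℝ (fderiv ℝ (newtonFar r₀ r₁))))) ∧
    (∃ M, HasDecay 3 M (fderiv ℝ (fderiv ℝ (fderiv ℝ (fderiv ℝ (newtonFar r₀ r₁)))))) := by
  have hr1 : 0 ≤ r₁ := (h₀.trans h₁).le
  have hΓ : ContDiff ℝ ∞ (newtonFar r₀ r₁) := contDiff_newtonFar h₀ h₁
  have hc2 : Continuous (fderiv ℝ (fderiv ℝ (newtonFar r₀ r₁))) :=
    (hΓ.fderiv_right (m := ∞) le_rfl |>.fderiv_right (m := ∞) le_rfl).continuous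
  have hc3 : Continuous (fderiv ℝ (fderiv ℝ (fderiv ℝ (newtonFar r₀ r₁)))) :=
    ((hΓ.fderiv_right (m := ∞) le_rfl).fderiv_right (m := ∞) le_rfl |>.fderiv_right (m := ∞) le_rfl).continuous
  have hc4 : Continuous (fderiv ℝ (fderiv ℝ (fderiv ℝ (fderiv ℝ (newtonFar r₀ r₁))))) :=
    (((hΓ.fderiv_right (m := ∞) le_rfl).fderiv_right (m := ∞) le_rfl).fderiv_right (m := ∞) le_rfl
      |>.fderiv_right (m := ∞) le_rfl).continuous
  have heq := fun z (hz : r₁ < ‖z‖) => newtonFar_fderiv_iterates_eq h₀.le h₁ hz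
  obtain ⟨M2, hM20, hM2⟩ := exists_decay_of_homogeneous _ (-3) (by norm_num) fderiv2_newtonKernel_homogeneous
    (contDiffOn_fderiv2_newtonKernel (n := 0)).continuousOn
  obtain ⟨M3, hM30, hM3⟩ := exists_decay_of_homogeneous _ (-4) (by norm_num) fderiv3_newtonKernel_homogeneous
    (contDiffOn_fderiv3_newtonKernel (n := 0)).continuousOn
  obtain ⟨M4, hM40, hM4⟩ := exists_decay_of_homogeneous _ (-5) (by norm_num) fderiv4_newtonKernel_homogeneous
    (contDiffOn_fderiv4_newtonKernel (n := 0)).continuousOn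
  exact ⟨hasDecay_three_of_eqOn_far hc2 hr1 (fun z hz => (heq z hz).2.2.1) hM20 (by norm_num) hM2,
    hasDecay_three_of_eqOn_far hc3 hr1 (fun z hz => (heq z hz).2.2.2.1) hM30 (by norm_num) hM3,
    hasDecay_three_of_eqOn_far hc4 hr1 (fun z hz => (heq z hz).2.2.2.2) hM40 (by norm_num) hM4⟩

/-! ### The far potential for the decay class `(1+|y|)|v(y)| ≤ C` -/

/-- The weight `y ↦ evalDiag (v y)` decays like `(1+|y|)⁻²` when `(1+|y|)|v(y)| ≤ C`. [folklore] -/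
theorem hasDecay_two_evalDiag {v : ℝ³ → ℝ³} {C : ℝ} (hv : ∀ y, ‖v y‖ ≤ C / (1 + ‖y‖)) :
    HasDecay 2 (C ^ 2) (fun y => evalDiag (v y)) := fun y => by
  have h1 : 0 < 1 + ‖y‖ := by positivity
  have hC : 0 ≤ C := by
    have := (norm_nonneg _).trans (hv 0); simp at this; exact this
  calc ‖evalDiag (v y)‖ ≤ ‖v y‖ ^ 2 := norm_evalDiag_le (v y)
    _ ≤ (C / (1 + ‖y‖)) ^ 2 := pow_le_pow_left₀ (norm_nonneg _) (hv y) 2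
    _ = C ^ 2 / (1 + ‖y‖) ^ 2 := by rw [div_pow]

/-- **`Q₂[v] ∈ C²`** with the formula `∂ₐ∂ₐQ₂[v](x) = ∫ D⁴Γ∞(x - y)(a, a, v y, v y) dy`, for `v`
continuous with `(1+|y|)|v(y)| ≤ C` (decaying kernels `D²Γ∞, D³Γ∞, D⁴Γ∞` against the
non-integrable weight `v ⊗ v = O((1+|y|)⁻²)`). [folklore] -/
theorem contDiff_farPotential_decay (h₀ : 0 < r₀) (h₁ : r₀ < r₁) {v : ℝ³ → ℝ³} (hvc : Continuous v)
    {C : ℝ} (hv : ∀ y, ‖v y‖ ≤ C / (1 + ‖y‖)) :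
    ContDiff ℝ 2 (farPotential r₀ r₁ v) ∧
      ∀ x a, fderiv ℝ (fun x' => fderiv ℝ (farPotential r₀ r₁ v) x' a) x a =
        ∫ y, fderiv ℝ (fderiv ℝ (fderiv ℝ (fderiv ℝ (newtonFar r₀ r₁)))) (x - y) a a (v y) (v y) := by
  obtain ⟨⟨M₀, hM₀⟩, ⟨M₁, hM₁⟩, ⟨M₂, hM₂⟩⟩ := exists_hasDecay_fderiv_newtonFar h₀ h₁
  have h := contDiff_two_integral_clm_apply_comp_sub_decay (L := fun y => evalDiag (v y))
    (contDiff_fderiv2_newtonFar h₀ h₁) hM₀ hM₁ hM₂ (continuous_evalDiag.comp hvc) (hasDecay_two_evalDiag hv)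
  rw [farPotential_eq]
  refine ⟨h.1, fun x a => ?_⟩
  rw [h.2 x a]
  rfl

/-- **`ΔQ₂[v] = λ * G[v]`** for `v ∈ C²` with `(1+|y|)|v(y)| ≤ C` (as `laplacian_farPotential`,
with the decay-class parametric integrals). [cite: GilbargTrudinger2001, Lemma 4.2] -/
theorem laplacian_farPotential_decay (h₀ : 0 < r₀) (h₁ : r₀ < r₁) {v : ℝ³ → ℝ³} (hv2 : ContDiff ℝ 2 v)
    {C : ℝ} (hv : ∀ y, ‖v y‖ ≤ C / (1 + ‖y‖)) (x : ℝ³) :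
    Δ (farPotential r₀ r₁ v) x = ∫ z, newtonFarLaplacian r₀ r₁ z * pressureSource v (x - z) := by
  set b := stdOrthonormalBasis ℝ ℝ³
  obtain ⟨hQ, hQ2⟩ := contDiff_farPotential_decay h₀ h₁ hv2.continuous hv
  rw [FluidPDE.laplacian_eq_sum_fderiv_fderiv b hQ x]
  simp_rw [hQ2]
  -- integrability of each summand
  obtain ⟨-, -, ⟨M₂, hM₂⟩⟩ := exists_hasDecay_fderiv_newtonFar h₀ h₁
  set D4 := fderiv ℝ (fderiv ℝ (fderiv ℝ (fderiv ℝ (newtonFar r₀ r₁)))) with hD4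
  have hD4c : Continuous D4 :=
    ((contDiff_fderiv2_newtonFar h₀ h₁).fderiv_right (m := 1) le_rfl).continuous_fderiv one_ne_zero
  have hint : ∀ i, Integrable fun y => D4 (x - y) (b i) (b i) (v y) (v y) := fun i => by
    have hΦc : Continuous fun z => D4 z (b i) (b i) :=
      (hD4c.clm_apply continuous_const).clm_apply continuous_const
    have hΦb : HasDecay 3 (M₂ * ‖b i‖ * ‖b i‖) (fun z => D4 z (b i) (b i)) := fun z =>
      calc ‖D4 z (b i) (b i)‖ ≤ ‖D4 z (b i)‖ * ‖b i‖ := ContinuousLinearMap.le_opNorm _ _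
        _ ≤ ‖D4 z‖ * ‖b i‖ * ‖b i‖ := by gcongr; exact ContinuousLinearMap.le_opNorm _ _
        _ ≤ M₂ / (1 + ‖z‖) ^ 3 * ‖b i‖ * ‖b i‖ := by gcongr; exact hM₂ z
        _ = M₂ * ‖b i‖ * ‖b i‖ / (1 + ‖z‖) ^ 3 := by ring
    exact integrable_clm_apply_comp_sub_decay (L := fun y => evalDiag (v y)) hΦc hΦb
      (continuous_evalDiag.comp hv2.continuous) (hasDecay_two_evalDiag hv) x
  rw [← integral_finsetSum _ fun i _ => hint i]
  have key : ∀ y, ∑ i, D4 (x - y) (b i) (b i) (v y) (v y) =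
      fderiv ℝ (fderiv ℝ (newtonFarLaplacian r₀ r₁)) (x - y) (v y) (v y) := fun y =>
    sum_fderiv4_newtonFar_apply h₀ h₁ b (x - y) (v y)
  rw [integral_congr_ae (Eventually.of_forall key)]
  -- double integration by parts with the test function `λ`
  have hlam : ContDiff ℝ 2 (newtonFarLaplacian r₀ r₁) := contDiff_newtonFarLaplacian h₀ h₁
  rw [← integral_comp_sub_mul_pressureSource hlam (hasCompactSupport_newtonFarLaplacian h₀.le h₁)
    hv2 x, ← integral_sub_left_eq_self
    (fun z => newtonFarLaplacian r₀ r₁ z * pressureSource v (x - z)) volume x]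
  simp only [sub_sub_cancel]

/-- **`Q[v] ∈ C²`** for `v ∈ C⁴` with `(1+|y|)|v(y)| ≤ C`. [cite: GilbargTrudinger2001, Lemma 4.2] -/
theorem contDiff_pressurePotential_decay {v : ℝ³ → ℝ³} (hv4 : ContDiff ℝ 4 v)
    {C : ℝ} (hv : ∀ y, ‖v y‖ ≤ C / (1 + ‖y‖)) : ContDiff ℝ 2 (pressurePotential v) := by
  have h1 : ContDiff ℝ 2 (nearPotential 1 2 v) :=
    contDiff_nearPotential zero_le_one one_lt_two 2 (by exact_mod_cast hv4)
  have h2 : ContDiff ℝ 2 (farPotential 1 2 v) :=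
    (contDiff_farPotential_decay one_pos one_lt_two hv4.continuous hv).1
  exact h1.neg.sub h2

/-- **The Poisson equation `ΔQ[v] = −∂ᵢ∂ⱼ(vᵢvⱼ)` for the decay class**: for `v ∈ C⁴` with
`(1+|y|)|v(y)| ≤ C` — in particular for every time slice of a Type I velocity field, which is
not square integrable. [cite: GilbargTrudinger2001, Lemma 4.2] -/
theorem laplacian_pressurePotential_decay {v : ℝ³ → ℝ³} (hv4 : ContDiff ℝ 4 v)
    {C : ℝ} (hv : ∀ y, ‖v y‖ ≤ C / (1 + ‖y‖)) (x : ℝ³) :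
    Δ (pressurePotential v) x = -pressureSource v x := by
  have h1 : ContDiff ℝ 2 (nearPotential 1 2 v) :=
    contDiff_nearPotential zero_le_one one_lt_two 2 (by exact_mod_cast hv4)
  have h2 : ContDiff ℝ 2 (farPotential 1 2 v) :=
    (contDiff_farPotential_decay one_pos one_lt_two hv4.continuous hv).1
  have e : pressurePotential v = -(nearPotential 1 2 v + farPotential 1 2 v) := by
    funext y
    simp only [pressurePotential, Pi.neg_apply, Pi.add_apply]
    ring
  rw [e, laplacian_neg, Pi.neg_apply, (h1.contDiffAt).laplacian_add h2.contDiffAt,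
    laplacian_nearPotential one_pos one_lt_two hv4,
    laplacian_farPotential_decay one_pos one_lt_two (hv4.of_le (by norm_num)) hv]
  ring

end NewtonDecay

end PineauVicol2026

end Literature.Analysis.FluidPDE
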